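import Mathlib
import Summits.Ventures.HodgeRepro.Statements

/-!
# What the seesaw isometry forces on the slot table (sealed statement (b), blind cell `pub-hodge-repro`, seat p2)

The sealed conjuncts of `MuTable` are bookkeeping of `Function.update`; they never use the field `iso` of a
`SeesawDatum` (the `GL₂(L)`-congruence `ḡᵀ · diag(a₀, a₁) · g = diag(a₂, a₃)`), nor the hypotheses on `δ`.  This file
records what those hypotheses DO force, proved from the definitions as printed in `Statements.lean`:

* `embedding_complexConj`, `im_embedding_eq_zero_of_conj_eq`, `re_embedding_eq_zero_of_conj_eq_neg`,
  `im_embedding_ne_zero_of_conj_eq_neg` — at an infinite place `w`, real elements (`ā = a`) have real image and a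
  non-zero purely imaginary `δ` has non-zero imaginary part (so the sign `0 < im w(δ)` in `slotDelta` is a genuine sign);
* `SeesawDatum.a_two_eq`, `a_three_eq`, `det_eq` — the entries of the congruence: `a₂ = a₀ ḡ₀₀ g₀₀ + a₁ ḡ₁₀ g₁₀`,
  `a₃ = a₀ ḡ₀₁ g₀₁ + a₁ ḡ₁₁ g₁₁`, `a₂ a₃ = a₀ a₁ · (det g)(det g)‾`;
* `re_a_two`, `re_a_three` — their images at `w`: `re w(a₂) = re w(a₀) |w g₀₀|² + re w(a₁) |w g₁₀|²`, etc.;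
* **signature invariance** (`pos_pos`, `neg_neg`, `split_iff`): the planes `diag(a₀, a₁)` and `diag(a₂, a₃)` have the
  same signature at every infinite place — the ⇒ half of Landherr's classification (Deligne 1982, LNM 900, Prop. 4.1)
  for diagonal planes, proved by hand from the congruence (2 × 2, no general Sylvester law needed);
* **norm equivalence of discriminants** (`disc_normEquiv`): `a₀ a₁ = a₂ a₃ · x x̄` with `x = (det g)⁻¹`;

The consequences for the slot table `δ_S, δ₂, δ₃` and the seesaw swap are in `MuTableSwap.lean`.
-/

set_option autoImplicit false

noncomputable section

namespace Summit.Ventures.HodgeRepro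

namespace MuTable

open NumberField

variable {L : Type} [Field L] [NumberField L] [NumberField.IsCMField L]

/-! ### Embeddings of real and purely imaginary elements -/

/-- Every complex embedding of the CM field intertwines `complexConj` with complex conjugation (Mathlib's
`IsCMField.complexEmbedding_complexConj`, specialised to the embedding of an infinite place). -/
theorem embedding_complexConj (w : InfinitePlace L) (x : L) :
    w.embedding (IsCMField.complexConj L x) = (starRingEnd ℂ) (w.embedding x) :=
  IsCMField.complexEmbedding_complexConj L w.embedding x

/-- A real element (`ā = a`) has real image at every infinite place. -/
theorem im_embedding_eq_zero_of_conj_eq {w : InfinitePlace L} {a : L}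
    (ha : IsCMField.complexConj L a = a) : (w.embedding a).im = 0 := by
  have h := embedding_complexConj w a
  rw [ha] at h
  have h' := congrArg Complex.im h
  rw [Complex.conj_im] at h'
  linarith

/-- A purely imaginary element (`δ̄ = -δ`) has purely imaginary image at every infinite place. -/
theorem re_embedding_eq_zero_of_conj_eq_neg {w : InfinitePlace L} {δ : L}
    (hδ : IsCMField.complexConj L δ = -δ) : (w.embedding δ).re = 0 := by
  have h := embedding_complexConj w δ
  rw [hδ, map_neg] at h
  have h' := congrArg Complex.re h
  rw [Complex.neg_re, Complex.conj_re] at h'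
  linarith

/-- A non-zero purely imaginary element has non-zero imaginary part at every infinite place: the sign
`0 < im w(δ)` used by `slotDelta` is a genuine sign. -/
theorem im_embedding_ne_zero_of_conj_eq_neg {w : InfinitePlace L} {δ : L}
    (hδ : IsCMField.complexConj L δ = -δ) (hδ0 : δ ≠ 0) : (w.embedding δ).im ≠ 0 := by
  intro him
  apply hδ0
  apply w.embedding.injective
  rw [map_zero]
  exact Complex.ext (by rw [re_embedding_eq_zero_of_conj_eq_neg hδ, Complex.zero_re])
    (by rw [him, Complex.zero_im])

/-! ### The entries of the congruence `ḡᵀ · diag(a₀, a₁) · g = diag(a₂, a₃)` -/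

namespace SeesawDatum

/-- Entry `(0,0)` of the congruence: `a₂ = a₀ · ḡ₀₀ g₀₀ + a₁ · ḡ₁₀ g₁₀`. -/
theorem a_two_eq (S : SeesawDatum L) {g : GL (Fin 2) L} (hg : ((g : Matrix (Fin 2) (Fin 2) L).transpose.map (IsCMField.complexConj L)) *
      Matrix.diagonal ![S.a 0, S.a 1] * (g : Matrix (Fin 2) (Fin 2) L) = Matrix.diagonal ![S.a 2, S.a 3]) :
    S.a 2 = S.a 0 * (IsCMField.complexConj L ((g : Matrix (Fin 2) (Fin 2) L) 0 0) * (g : Matrix (Fin 2) (Fin 2) L) 0 0)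
      + S.a 1 * (IsCMField.complexConj L ((g : Matrix (Fin 2) (Fin 2) L) 1 0) * (g : Matrix (Fin 2) (Fin 2) L) 1 0) := by
  have h := congrFun (congrFun hg 0) 0
  simp only [Matrix.mul_apply, Fin.sum_univ_two, Matrix.diagonal_apply, Matrix.transpose_apply,
    Matrix.map_apply] at h
  simp at h
  rw [← h]
  ring

/-- Entry `(1,1)` of the congruence: `a₃ = a₀ · ḡ₀₁ g₀₁ + a₁ · ḡ₁₁ g₁₁`. -/
theorem a_three_eq (S : SeesawDatum L) {g : GL (Fin 2) L} (hg : ((g : Matrix (Fin 2) (Fin 2) L).transpose.map (IsCMField.complexConj L)) *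
      Matrix.diagonal ![S.a 0, S.a 1] * (g : Matrix (Fin 2) (Fin 2) L) = Matrix.diagonal ![S.a 2, S.a 3]) :
    S.a 3 = S.a 0 * (IsCMField.complexConj L ((g : Matrix (Fin 2) (Fin 2) L) 0 1) * (g : Matrix (Fin 2) (Fin 2) L) 0 1)
      + S.a 1 * (IsCMField.complexConj L ((g : Matrix (Fin 2) (Fin 2) L) 1 1) * (g : Matrix (Fin 2) (Fin 2) L) 1 1) := by
  have h := congrFun (congrFun hg 1) 1
  simp only [Matrix.mul_apply, Fin.sum_univ_two, Matrix.diagonal_apply, Matrix.transpose_apply,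
    Matrix.map_apply] at h
  simp at h
  rw [← h]
  ring

/-- Determinants of the congruence: `a₂ a₃ = a₀ a₁ · (det g)‾ (det g)`. -/
theorem det_eq (S : SeesawDatum L) {g : GL (Fin 2) L} (hg : ((g : Matrix (Fin 2) (Fin 2) L).transpose.map (IsCMField.complexConj L)) *
      Matrix.diagonal ![S.a 0, S.a 1] * (g : Matrix (Fin 2) (Fin 2) L) = Matrix.diagonal ![S.a 2, S.a 3]) :
    S.a 2 * S.a 3 = S.a 0 * S.a 1 *
      (IsCMField.complexConj L (g : Matrix (Fin 2) (Fin 2) L).det * (g : Matrix (Fin 2) (Fin 2) L).det) := by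
  have h := congrArg Matrix.det hg
  rw [Matrix.det_mul, Matrix.det_mul, Matrix.det_diagonal, Matrix.det_diagonal, Fin.prod_univ_two,
    Fin.prod_univ_two, Matrix.transpose_map, Matrix.det_transpose, ← AlgEquiv.mapMatrix_apply,
    ← AlgEquiv.map_det] at h
  simp at h
  rw [← h]
  ring

omit [NumberField L] [IsCMField L] in
/-- The determinant of `g ∈ GL₂(L)` is non-zero. -/
theorem det_ne_zero (g : GL (Fin 2) L) : (g : Matrix (Fin 2) (Fin 2) L).det ≠ 0 :=
  (Matrix.isUnits_det_units g).ne_zero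

omit [NumberField L] [IsCMField L] in
/-- The first column of `g ∈ GL₂(L)` is non-zero. -/
theorem col_zero_ne_zero (g : GL (Fin 2) L) :
    (g : Matrix (Fin 2) (Fin 2) L) 0 0 ≠ 0 ∨ (g : Matrix (Fin 2) (Fin 2) L) 1 0 ≠ 0 := by
  by_contra h
  simp only [not_or, not_not] at h
  apply det_ne_zero g
  rw [Matrix.det_fin_two, h.1, h.2]
  ring

omit [NumberField L] [IsCMField L] in
/-- The second column of `g ∈ GL₂(L)` is non-zero. -/
theorem col_one_ne_zero (g : GL (Fin 2) L) :
    (g : Matrix (Fin 2) (Fin 2) L) 0 1 ≠ 0 ∨ (g : Matrix (Fin 2) (Fin 2) L) 1 1 ≠ 0 := by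
  by_contra h
  simp only [not_or, not_not] at h
  apply det_ne_zero g
  rw [Matrix.det_fin_two, h.1, h.2]
  ring

/-! ### The entries at an infinite place -/

/-- `re w(a_i)`: the real number whose sign `slotDelta` and `conjSwapAt` read. -/
def r (S : SeesawDatum L) (w : InfinitePlace L) (i : Fin 4) : ℝ := (w.embedding (S.a i)).re

/-- `r` unfolds to the real part of `w(a_i)`. -/
theorem r_def (S : SeesawDatum L) (w : InfinitePlace L) (i : Fin 4) : S.r w i = (w.embedding (S.a i)).re := rfl

/-- `w(a_i)` is real. -/
theorem im_embedding_a (S : SeesawDatum L) (w : InfinitePlace L) (i : Fin 4) : (w.embedding (S.a i)).im = 0 :=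
  im_embedding_eq_zero_of_conj_eq (S.a_real i)

/-- `w(a_i) = re w(a_i)` as a complex number. -/
theorem embedding_a_eq (S : SeesawDatum L) (w : InfinitePlace L) (i : Fin 4) :
    w.embedding (S.a i) = (S.r w i : ℂ) :=
  Complex.ext (by simp [r_def]) (by simp [im_embedding_a])

/-- `re w(a_i) ≠ 0`. -/
theorem r_ne_zero (S : SeesawDatum L) (w : InfinitePlace L) (i : Fin 4) : S.r w i ≠ 0 := by
  intro h
  apply S.a_ne i
  apply w.embedding.injective
  rw [map_zero, embedding_a_eq, h, Complex.ofReal_zero]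

/-- `w(x̄ x) = |w(x)|²` as a complex number. -/
theorem embedding_conj_mul_self (w : InfinitePlace L) (x : L) :
    w.embedding (IsCMField.complexConj L x * x) = (Complex.normSq (w.embedding x) : ℂ) := by
  rw [map_mul, embedding_complexConj, Complex.normSq_eq_conj_mul_self]

/-- `re w(a₂) = re w(a₀) |w g₀₀|² + re w(a₁) |w g₁₀|²`. -/
theorem r_two (S : SeesawDatum L) (w : InfinitePlace L) {g : GL (Fin 2) L} (hg : ((g : Matrix (Fin 2) (Fin 2) L).transpose.map (IsCMField.complexConj L)) *
      Matrix.diagonal ![S.a 0, S.a 1] * (g : Matrix (Fin 2) (Fin 2) L) = Matrix.diagonal ![S.a 2, S.a 3]) :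
    S.r w 2 = S.r w 0 * Complex.normSq (w.embedding ((g : Matrix (Fin 2) (Fin 2) L) 0 0))
      + S.r w 1 * Complex.normSq (w.embedding ((g : Matrix (Fin 2) (Fin 2) L) 1 0)) := by
  have h := congrArg (fun x => (w.embedding x).re) (S.a_two_eq hg)
  simp only [map_add, map_mul, embedding_a_eq, embedding_complexConj, ← Complex.normSq_eq_conj_mul_self,
    Complex.add_re, Complex.mul_re, Complex.ofReal_re, Complex.ofReal_im, mul_zero, sub_zero] at h
  exact h

/-- `re w(a₃) = re w(a₀) |w g₀₁|² + re w(a₁) |w g₁₁|²`. -/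
theorem r_three (S : SeesawDatum L) (w : InfinitePlace L) {g : GL (Fin 2) L} (hg : ((g : Matrix (Fin 2) (Fin 2) L).transpose.map (IsCMField.complexConj L)) *
      Matrix.diagonal ![S.a 0, S.a 1] * (g : Matrix (Fin 2) (Fin 2) L) = Matrix.diagonal ![S.a 2, S.a 3]) :
    S.r w 3 = S.r w 0 * Complex.normSq (w.embedding ((g : Matrix (Fin 2) (Fin 2) L) 0 1))
      + S.r w 1 * Complex.normSq (w.embedding ((g : Matrix (Fin 2) (Fin 2) L) 1 1)) := by
  have h := congrArg (fun x => (w.embedding x).re) (S.a_three_eq hg)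
  simp only [map_add, map_mul, embedding_a_eq, embedding_complexConj, ← Complex.normSq_eq_conj_mul_self,
    Complex.add_re, Complex.mul_re, Complex.ofReal_re, Complex.ofReal_im, mul_zero, sub_zero] at h
  exact h

/-- `re w(a₂) · re w(a₃) = re w(a₀) · re w(a₁) · |w(det g)|²`. -/
theorem r_two_mul_r_three (S : SeesawDatum L) (w : InfinitePlace L) {g : GL (Fin 2) L} (hg : ((g : Matrix (Fin 2) (Fin 2) L).transpose.map (IsCMField.complexConj L)) *
      Matrix.diagonal ![S.a 0, S.a 1] * (g : Matrix (Fin 2) (Fin 2) L) = Matrix.diagonal ![S.a 2, S.a 3]) :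
    S.r w 2 * S.r w 3 = S.r w 0 * S.r w 1 * Complex.normSq (w.embedding (g : Matrix (Fin 2) (Fin 2) L).det) := by
  have h := congrArg (fun x => (w.embedding x).re) (S.det_eq hg)
  simp only [map_mul, embedding_a_eq, embedding_complexConj, ← Complex.normSq_eq_conj_mul_self,
    Complex.mul_re, Complex.mul_im, Complex.ofReal_re, Complex.ofReal_im, mul_zero, zero_mul, sub_zero,
    add_zero] at h
  exact h

/-! ### Signature invariance at every infinite place (the ⇒ half of Landherr's classification for diagonal planes) -/

/-- Two non-zero reals have the same sign iff their product is positive. -/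
theorem mul_pos_iff_same_sign {x y : ℝ} (hx : x ≠ 0) (hy : y ≠ 0) : 0 < x * y ↔ (0 < x ↔ 0 < y) := by
  rcases lt_or_gt_of_ne hx with hx' | hx' <;> rcases lt_or_gt_of_ne hy with hy' | hy'
  · exact ⟨fun _ => ⟨fun h => absurd h (not_lt.2 hx'.le), fun h => absurd h (not_lt.2 hy'.le)⟩,
      fun _ => mul_pos_of_neg_of_neg hx' hy'⟩
  · exact ⟨fun h => absurd h (not_lt.2 (mul_nonpos_of_nonpos_of_nonneg hx'.le hy'.le)),
      fun h => absurd (h.2 hy') (not_lt.2 hx'.le)⟩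
  · exact ⟨fun h => absurd h (not_lt.2 (mul_nonpos_of_nonneg_of_nonpos hx'.le hy'.le)),
      fun h => absurd (h.1 hx') (not_lt.2 hy'.le)⟩
  · exact ⟨fun _ => ⟨fun _ => hy', fun _ => hx'⟩, fun _ => mul_pos hx' hy'⟩

/-- If `a₀, a₁` are both positive at `w`, so are `a₂, a₃` (the plane is positive definite at `w`). -/
theorem pos_pos (S : SeesawDatum L) (w : InfinitePlace L) (h0 : 0 < S.r w 0) (h1 : 0 < S.r w 1) :
    0 < S.r w 2 ∧ 0 < S.r w 3 := by
  obtain ⟨g, hg⟩ := S.iso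
  constructor
  · rw [S.r_two w hg]
    rcases col_zero_ne_zero g with h | h
    · have hp : 0 < Complex.normSq (w.embedding ((g : Matrix (Fin 2) (Fin 2) L) 0 0)) :=
        Complex.normSq_pos.2 ((map_ne_zero _).2 h)
      have := mul_pos h0 hp
      have := mul_nonneg h1.le (Complex.normSq_nonneg (w.embedding ((g : Matrix (Fin 2) (Fin 2) L) 1 0)))
      linarith
    · have hp : 0 < Complex.normSq (w.embedding ((g : Matrix (Fin 2) (Fin 2) L) 1 0)) :=
        Complex.normSq_pos.2 ((map_ne_zero _).2 h)
      have := mul_pos h1 hp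
      have := mul_nonneg h0.le (Complex.normSq_nonneg (w.embedding ((g : Matrix (Fin 2) (Fin 2) L) 0 0)))
      linarith
  · rw [S.r_three w hg]
    rcases col_one_ne_zero g with h | h
    · have hp : 0 < Complex.normSq (w.embedding ((g : Matrix (Fin 2) (Fin 2) L) 0 1)) :=
        Complex.normSq_pos.2 ((map_ne_zero _).2 h)
      have := mul_pos h0 hp
      have := mul_nonneg h1.le (Complex.normSq_nonneg (w.embedding ((g : Matrix (Fin 2) (Fin 2) L) 1 1)))
      linarith
    · have hp : 0 < Complex.normSq (w.embedding ((g : Matrix (Fin 2) (Fin 2) L) 1 1)) :=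
        Complex.normSq_pos.2 ((map_ne_zero _).2 h)
      have := mul_pos h1 hp
      have := mul_nonneg h0.le (Complex.normSq_nonneg (w.embedding ((g : Matrix (Fin 2) (Fin 2) L) 0 1)))
      linarith

/-- If `a₀, a₁` are both negative at `w`, so are `a₂, a₃` (the plane is negative definite at `w`). -/
theorem neg_neg (S : SeesawDatum L) (w : InfinitePlace L) (h0 : S.r w 0 < 0) (h1 : S.r w 1 < 0) :
    S.r w 2 < 0 ∧ S.r w 3 < 0 := by
  obtain ⟨g, hg⟩ := S.iso
  constructor
  · rw [S.r_two w hg]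
    rcases col_zero_ne_zero g with h | h
    · have hp : 0 < Complex.normSq (w.embedding ((g : Matrix (Fin 2) (Fin 2) L) 0 0)) :=
        Complex.normSq_pos.2 ((map_ne_zero _).2 h)
      have := mul_neg_of_neg_of_pos h0 hp
      have := mul_nonpos_of_nonpos_of_nonneg h1.le
        (Complex.normSq_nonneg (w.embedding ((g : Matrix (Fin 2) (Fin 2) L) 1 0)))
      linarith
    · have hp : 0 < Complex.normSq (w.embedding ((g : Matrix (Fin 2) (Fin 2) L) 1 0)) :=
        Complex.normSq_pos.2 ((map_ne_zero _).2 h)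
      have := mul_neg_of_neg_of_pos h1 hp
      have := mul_nonpos_of_nonpos_of_nonneg h0.le
        (Complex.normSq_nonneg (w.embedding ((g : Matrix (Fin 2) (Fin 2) L) 0 0)))
      linarith
  · rw [S.r_three w hg]
    rcases col_one_ne_zero g with h | h
    · have hp : 0 < Complex.normSq (w.embedding ((g : Matrix (Fin 2) (Fin 2) L) 0 1)) :=
        Complex.normSq_pos.2 ((map_ne_zero _).2 h)
      have := mul_neg_of_neg_of_pos h0 hp
      have := mul_nonpos_of_nonpos_of_nonneg h1.le
        (Complex.normSq_nonneg (w.embedding ((g : Matrix (Fin 2) (Fin 2) L) 1 1)))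
      linarith
    · have hp : 0 < Complex.normSq (w.embedding ((g : Matrix (Fin 2) (Fin 2) L) 1 1)) :=
        Complex.normSq_pos.2 ((map_ne_zero _).2 h)
      have := mul_neg_of_neg_of_pos h1 hp
      have := mul_nonpos_of_nonpos_of_nonneg h0.le
        (Complex.normSq_nonneg (w.embedding ((g : Matrix (Fin 2) (Fin 2) L) 0 1)))
      linarith

/-- `a₀, a₁` have the same sign at `w` iff `a₂, a₃` do (the plane is definite at `w` for one pair iff for the other). -/
theorem same_sign_iff (S : SeesawDatum L) (w : InfinitePlace L) :
    (0 < S.r w 0 ↔ 0 < S.r w 1) ↔ (0 < S.r w 2 ↔ 0 < S.r w 3) := by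
  obtain ⟨g, hg⟩ := S.iso
  have hD : 0 < Complex.normSq (w.embedding (g : Matrix (Fin 2) (Fin 2) L).det) :=
    Complex.normSq_pos.2 ((map_ne_zero _).2 (det_ne_zero g))
  rw [← mul_pos_iff_same_sign (S.r_ne_zero w 0) (S.r_ne_zero w 1),
    ← mul_pos_iff_same_sign (S.r_ne_zero w 2) (S.r_ne_zero w 3), S.r_two_mul_r_three w hg,
    mul_pos_iff_of_pos_right hD]

/-- `w` is a SPLIT place (signature `(1,1)`) for `(a₀, a₁)` iff it is one for `(a₂, a₃)`. -/
theorem split_iff (S : SeesawDatum L) (w : InfinitePlace L) :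
    ¬ (0 < S.r w 0 ↔ 0 < S.r w 1) ↔ ¬ (0 < S.r w 2 ↔ 0 < S.r w 3) :=
  not_congr (S.same_sign_iff w)

/-- **Signature invariance**: the number of positive entries of `diag(a₀, a₁)` at `w` equals that of
`diag(a₂, a₃)` — the ⇒ half of Landherr's classification (Deligne 1982, Prop. 4.1) for these planes. -/
theorem posCount_eq (S : SeesawDatum L) (w : InfinitePlace L) :
    ((if 0 < S.r w 0 then 1 else 0) + (if 0 < S.r w 1 then 1 else 0) : ℕ) =
      (if 0 < S.r w 2 then 1 else 0) + (if 0 < S.r w 3 then 1 else 0) := by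
  by_cases h0 : 0 < S.r w 0 <;> by_cases h1 : 0 < S.r w 1
  · obtain ⟨h2, h3⟩ := S.pos_pos w h0 h1
    simp [h0, h1, h2, h3]
  · have hs : ¬ (0 < S.r w 2 ↔ 0 < S.r w 3) := (S.split_iff w).1 (fun h => h1 (h.1 h0))
    by_cases h2 : 0 < S.r w 2 <;> by_cases h3 : 0 < S.r w 3
    · exact absurd ⟨fun _ => h3, fun _ => h2⟩ hs
    · simp [h0, h1, h2, h3]
    · simp [h0, h1, h2, h3]
    · exact absurd ⟨fun h => absurd h h2, fun h => absurd h h3⟩ hs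
  · have hs : ¬ (0 < S.r w 2 ↔ 0 < S.r w 3) := (S.split_iff w).1 (fun h => h0 (h.2 h1))
    by_cases h2 : 0 < S.r w 2 <;> by_cases h3 : 0 < S.r w 3
    · exact absurd ⟨fun _ => h3, fun _ => h2⟩ hs
    · simp [h0, h1, h2, h3]
    · simp [h0, h1, h2, h3]
    · exact absurd ⟨fun h => absurd h h2, fun h => absurd h h3⟩ hs
  · have h0' : S.r w 0 < 0 := lt_of_le_of_ne (not_lt.1 h0) (S.r_ne_zero w 0)
    have h1' : S.r w 1 < 0 := lt_of_le_of_ne (not_lt.1 h1) (S.r_ne_zero w 1)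
    obtain ⟨h2, h3⟩ := S.neg_neg w h0' h1'
    simp [h0, h1, not_lt.2 h2.le, not_lt.2 h3.le]

/-! ### The discriminants are norm-equivalent -/

/-- **Discriminant invariance**: `a₀ a₁ = a₂ a₃ · x x̄` with `x = (det g)⁻¹` — the discriminants of the two planes
agree in `L⁺^× / Nm_{L/L⁺}(L^×)` (the second invariant of Landherr's classification). -/
theorem disc_normEquiv (S : SeesawDatum L) :
    ∃ x : L, x ≠ 0 ∧ S.a 0 * S.a 1 = S.a 2 * S.a 3 * (x * IsCMField.complexConj L x) := by
  obtain ⟨g, hg⟩ := S.iso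
  have hd : (g : Matrix (Fin 2) (Fin 2) L).det ≠ 0 := det_ne_zero g
  have hcd : IsCMField.complexConj L (g : Matrix (Fin 2) (Fin 2) L).det ≠ 0 := (map_ne_zero _).2 hd
  refine ⟨(g : Matrix (Fin 2) (Fin 2) L).det⁻¹, inv_ne_zero hd, ?_⟩
  rw [S.det_eq hg, map_inv₀]
  field_simp

end SeesawDatum

end MuTable

end Summit.Ventures.HodgeRepro

end
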